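import Literature.Analysis.FunctionSpaces.ContDiffHolderClosedGraph
import Literature.Analysis.FunctionSpaces.ContDiffHolderLocalization
import Literature.Analysis.FunctionSpaces.ContDiffHolderCompactInclusion
import Literature.Analysis.FunctionSpaces.ContDiffHolderCompactness
import Literature.Analysis.FunctionSpaces.ContDiffHolderDiffOperator
import Mathlib.Analysis.Calculus.BumpFunction.InnerProduct
import Mathlib.Analysis.Complex.Basic
import HarnessLib

/-!
# Hölder spaces of sections of line bundles over the Riemann sphere, in two charts

Topic `Literature/Analysis/Complex`. The Riemann sphere `S² = ℂ ∪ {∞}` is covered by the two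
charts `z` and `w = z⁻¹`; a smooth complex line bundle over it is described by a clutching function
`τ : ℂ ∖ {0} → ℂ ∖ {0}`, a section being a pair of chart representatives `f₀, f₁ : ℂ → F` with

  `f₁ w = τ w • f₀ w⁻¹`  (`w ≠ 0`)

(`τ = 1`: functions on `S²`, the convention `v z = u z⁻¹` of the two-chart `J`-spheres of
`Literature/Geometry/Symplectic/JSphereLocalFoliation.lean`; `τ w = -(conj w)⁻²`: `(0,1)`-forms
`f₀ dz̄ = f₁ dw̄`; `τ w = -w²`: vector fields). Following the chart-piece definition of Hölder
spaces on a compact manifold (Joyce 2007, §1.2; the tree's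
`Literature/Analysis/FunctionSpaces/HolderSpaceManifold.lean`) we let `ρ` be a smooth radial
cutoff equal to `1` on `‖z‖ ≤ 2` and supported in `‖z‖ < 3`, and call the pair of **pieces**
`(ρ • f₀, ρ • f₁)` the coordinates of the section; the discs `‖z‖ < 2`, `‖w‖ < 2` cover `S²`.

* `RiemannSphere.holderSections F τ k r` — the space `𝓗^{k,r}_τ` of pairs
  `(g₀, g₁) ∈ C^{k,r}_b(ℂ, F)²` (the Banach spaces of
  `Literature/Analysis/FunctionSpaces/ContDiffHolderSpace.lean`) which ARE the pieces of a section: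
  this is the pair of closed linear conditions
  `g₀ z = ρ z • (τ z⁻¹)⁻¹ • g₁ z⁻¹` and `g₁ w = ρ w • τ w • g₀ w⁻¹` for `‖z‖, ‖w‖ ≥ 1/2`
  (`mem_holderSections_iff`: equivalent to `∃ f₀ f₁` clutched with `gᵢ = ρ • fᵢ`), a closed
  submodule of the product, hence a Banach space (`instCompleteSpace`);
* `sec₀`, `sec₁` — the chart representatives of a member, their clutching relation, the piece
  identities `g₀ = ρ • sec₀`, `g₁ = ρ • sec₁`, and their regularity (`contDiff_sec₀`);
* `SmoothSection.toHolder` — smooth clutched pairs are members of every `𝓗^{k,r}_τ`, `r ≤ 1`;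
* `inclCLM` — the inclusion `𝓗^{k+1,r}_τ → 𝓗^{k,r}_τ` and its compactness
  (`isCompactOperator_inclCLM`, Arzelà–Ascoli on the two pieces, which are supported in the
  fixed disc `‖z‖ ≤ 3`);
* `eval₀CLM` — evaluation of the `z`-representative at a point of the disc `‖z‖ < 2`.

Everything is proved; no named facts. This is layer B1 of the analytic core (automatic
transversality and the implicit function theorem for embedded `J`-spheres, Wendl 2018,
Thm. 2.44/2.46 and Prop. 2.53) recorded in the census of
`Literature.Geometry.Symplectic.hls_localFoliation_embeddedSphere_trivialNormal`.

## References

* D. D. Joyce, *Riemannian Holonomy Groups and Calibrated Geometry* (2007), §1.2. [Joyce2007]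
* C. Wendl, *Holomorphic Curves in Low Dimensions*, LNM 2216 (2018), §2.1.3. [Wendl2018]
* D. McDuff, D. Salamon, *J-holomorphic curves and symplectic topology*, 2nd ed. (2012), App. B.
  [McDuffSalamon2012]
-/

noncomputable section

open Set Filter Metric Function
open scoped Topology NNReal ContDiff

namespace Literature.Analysis.Complex

namespace RiemannSphere

open Literature.Analysis.FunctionSpaces

/-! ### The cutoff `ρ` -/

/-- The bump behind `ρ`: radii `2 < 3` about `0 ∈ ℂ`. [folklore] -/
def rhoCutBump : ContDiffBump (0 : ℂ) := ⟨2, 3, by norm_num, by norm_num⟩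

/-- **The cutoff `ρ`**: smooth, `= 1` on `‖z‖ ≤ 2`, `= 0` on `‖z‖ ≥ 3`, values in `[0, 1]`.
[folklore] -/
def rhoCut (z : ℂ) : ℝ := rhoCutBump z

/-- `ρ = 1` on the closed disc of radius `2`. [folklore] -/
theorem rhoCut_eq_one {z : ℂ} (hz : ‖z‖ ≤ 2) : rhoCut z = 1 :=
  rhoCutBump.one_of_mem_closedBall (by simpa [rhoCutBump] using hz)

/-- `ρ = 0` off the open disc of radius `3`. [folklore] -/
theorem rhoCut_eq_zero {z : ℂ} (hz : 3 ≤ ‖z‖) : rhoCut z = 0 :=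
  rhoCutBump.zero_of_le_dist (by simpa [rhoCutBump] using hz)

/-- `ρ ≥ 0`. [folklore] -/
theorem rhoCut_nonneg (z : ℂ) : 0 ≤ rhoCut z := rhoCutBump.nonneg

/-- `ρ ≤ 1`. [folklore] -/
theorem rhoCut_le_one (z : ℂ) : rhoCut z ≤ 1 := rhoCutBump.le_one

/-- `ρ` is smooth. [folklore] -/
theorem contDiff_rhoCut : ContDiff ℝ ∞ rhoCut := rhoCutBump.contDiff

/-- `ρ` has compact support. [folklore] -/
theorem hasCompactSupport_rhoCut : HasCompactSupport rhoCut := rhoCutBump.hasCompactSupport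

/-- `ρ` is supported in the closed disc of radius `3`. [folklore] -/
theorem tsupport_rhoCut_subset : tsupport rhoCut ⊆ closedBall (0 : ℂ) 3 := by
  rw [show rhoCut = (rhoCutBump : ℂ → ℝ) from rfl, rhoCutBump.tsupport_eq]
  simp [rhoCutBump]

/-- Points where `ρ ≠ 0` lie in the open disc of radius `3`. [folklore] -/
theorem norm_lt_three_of_rhoCut_ne_zero {z : ℂ} (hz : rhoCut z ≠ 0) : ‖z‖ < 3 := by
  by_contra h
  exact hz (rhoCut_eq_zero (not_lt.1 h))

/-! ### Elementary facts about inversion -/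

/-- `‖z‖ ≥ 1/2 ⇒ ‖z⁻¹‖ ≤ 2`. [folklore] -/
theorem norm_inv_le_two_of_half_le {z : ℂ} (hz : 2⁻¹ ≤ ‖z‖) : ‖z⁻¹‖ ≤ 2 := by
  rw [norm_inv]
  have h0 : (0 : ℝ) < ‖z‖ := lt_of_lt_of_le (by norm_num) hz
  calc ‖z‖⁻¹ ≤ (2⁻¹ : ℝ)⁻¹ := by
        exact inv_anti₀ (by norm_num) hz
    _ = 2 := by norm_num

/-- `‖z‖ > 1/2 ⇒ ‖z⁻¹‖ < 2`. [folklore] -/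
theorem norm_inv_lt_two_of_half_lt {z : ℂ} (hz : 2⁻¹ < ‖z‖) : ‖z⁻¹‖ < 2 := by
  rw [norm_inv]
  calc ‖z‖⁻¹ < (2⁻¹ : ℝ)⁻¹ := by
        exact inv_strictAnti₀ (by norm_num) hz
    _ = 2 := by norm_num

/-- `0 < ‖z‖ < 2 ⇒ ‖z⁻¹‖ > 1/2`. [folklore] -/
theorem half_lt_norm_inv_of_lt_two {z : ℂ} (hz0 : z ≠ 0) (hz : ‖z‖ < 2) : 2⁻¹ < ‖z⁻¹‖ := by
  rw [norm_inv]
  exact inv_strictAnti₀ (norm_pos_iff.2 hz0) hz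

/-- `‖z‖ ≥ 1/2 ⇒ z ≠ 0`. [folklore] -/
theorem ne_zero_of_half_le_norm {z : ℂ} (hz : 2⁻¹ ≤ ‖z‖) : z ≠ 0 := by
  rintro rfl
  norm_num at hz

/-- Inversion is real-smooth off the origin. [folklore] -/
theorem contDiffOn_inv : ContDiffOn ℝ ∞ (fun z : ℂ => z⁻¹) {z | z ≠ 0} := by
  intro z hz
  exact ((contDiffAt_inv ℂ hz).restrict_scalars ℝ).contDiffWithinAt

/-- The punctured plane is open. [folklore] -/
theorem isOpen_ne_zero : IsOpen {z : ℂ | z ≠ 0} := isOpen_ne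

/-! ### The space `𝓗^{k,r}_τ` -/

variable (F : Type) [NormedAddCommGroup F] [NormedSpace ℂ F]

/-- **The Hölder space `𝓗^{k,r}_τ(F)` of sections of the line bundle with clutching function `τ`
over the Riemann sphere**, as the closed submodule of pairs of pieces
`(g₀, g₁) ∈ C^{k,r}_b(ℂ, F)²` satisfying the two (closed, linear) piece relations; see
`mem_holderSections_iff` for the description by clutched chart representatives.
[cite: Joyce2007, §1.2] -/
def holderSections (τ : ℂ → ℂ) (k : ℕ) (r : ℝ≥0) :
    Submodule ℝ (ContDiffHolderFunction ℂ F k r × ContDiffHolderFunction ℂ F k r) where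
  carrier := {p | (∀ z : ℂ, 2⁻¹ ≤ ‖z‖ → p.1 z = ((rhoCut z : ℂ) * (τ z⁻¹)⁻¹) • p.2 z⁻¹) ∧
    ∀ w : ℂ, 2⁻¹ ≤ ‖w‖ → p.2 w = ((rhoCut w : ℂ) * τ w) • p.1 w⁻¹}
  add_mem' := by
    rintro p q ⟨hp1, hp2⟩ ⟨hq1, hq2⟩
    refine ⟨fun z hz => ?_, fun w hw => ?_⟩
    · simp only [Prod.fst_add, Prod.snd_add, ContDiffHolderFunction.coe_add, Pi.add_apply,
        hp1 z hz, hq1 z hz, smul_add]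
    · simp only [Prod.fst_add, Prod.snd_add, ContDiffHolderFunction.coe_add, Pi.add_apply,
        hp2 w hw, hq2 w hw, smul_add]
  zero_mem' := by
    refine ⟨fun z _ => ?_, fun w _ => ?_⟩ <;> simp
  smul_mem' := by
    rintro c p ⟨hp1, hp2⟩
    refine ⟨fun z hz => ?_, fun w hw => ?_⟩
    · simp only [Prod.smul_fst, Prod.smul_snd, ContDiffHolderFunction.coe_smul, Pi.smul_apply,
        hp1 z hz, smul_comm c]
    · simp only [Prod.smul_fst, Prod.smul_snd, ContDiffHolderFunction.coe_smul, Pi.smul_apply,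
        hp2 w hw, smul_comm c]

variable {F}

variable {τ : ℂ → ℂ} {k : ℕ} {r : ℝ≥0}

/-- Unfolding of membership in `𝓗^{k,r}_τ`: the two piece relations. [folklore] -/
theorem mem_holderSections {p : ContDiffHolderFunction ℂ F k r × ContDiffHolderFunction ℂ F k r} :
    p ∈ holderSections F τ k r ↔
      (∀ z : ℂ, 2⁻¹ ≤ ‖z‖ → p.1 z = ((rhoCut z : ℂ) * (τ z⁻¹)⁻¹) • p.2 z⁻¹) ∧
      ∀ w : ℂ, 2⁻¹ ≤ ‖w‖ → p.2 w = ((rhoCut w : ℂ) * τ w) • p.1 w⁻¹ := Iff.rfl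

/-- The piece relations are closed conditions. [folklore] -/
theorem isClosed_holderSections :
    IsClosed (holderSections F τ k r : Set (ContDiffHolderFunction ℂ F k r ×
      ContDiffHolderFunction ℂ F k r)) := by
  have h1 : ∀ z : ℂ, Continuous fun p : ContDiffHolderFunction ℂ F k r ×
      ContDiffHolderFunction ℂ F k r => p.1 z := fun z =>
    (ContDiffHolderFunction.evalCLM (E := ℂ) (F := F) (k := k) (r := r) z).continuous.comp
      continuous_fst
  have h2 : ∀ z : ℂ, Continuous fun p : ContDiffHolderFunction ℂ F k r ×
      ContDiffHolderFunction ℂ F k r => p.2 z := fun z =>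
    (ContDiffHolderFunction.evalCLM (E := ℂ) (F := F) (k := k) (r := r) z).continuous.comp
      continuous_snd
  have hA : IsClosed {p : ContDiffHolderFunction ℂ F k r × ContDiffHolderFunction ℂ F k r |
      ∀ z : ℂ, 2⁻¹ ≤ ‖z‖ → p.1 z = ((rhoCut z : ℂ) * (τ z⁻¹)⁻¹) • p.2 z⁻¹} := by
    simp only [setOf_forall]
    exact isClosed_iInter fun z => isClosed_iInter fun _ =>
      isClosed_eq (h1 z) ((h2 z⁻¹).const_smul _)
  have hB : IsClosed {p : ContDiffHolderFunction ℂ F k r × ContDiffHolderFunction ℂ F k r |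
      ∀ w : ℂ, 2⁻¹ ≤ ‖w‖ → p.2 w = ((rhoCut w : ℂ) * τ w) • p.1 w⁻¹} := by
    simp only [setOf_forall]
    exact isClosed_iInter fun w => isClosed_iInter fun _ =>
      isClosed_eq (h2 w) ((h1 w⁻¹).const_smul _)
  exact hA.inter hB

/-- `𝓗^{k,r}_τ(F)` is a Banach space. [folklore] -/
instance instCompleteSpace [CompleteSpace F] : CompleteSpace (holderSections F τ k r) :=
  isClosed_holderSections.completeSpace_coe

/-! ### Chart representatives of a member -/

/-- The `z`-chart representative of a member: `g₀` on the disc `‖z‖ < 2`, the transferred `g₁`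
outside. [folklore] -/
def sec₀ (τ : ℂ → ℂ) (p : ContDiffHolderFunction ℂ F k r × ContDiffHolderFunction ℂ F k r)
    (z : ℂ) : F :=
  if ‖z‖ < 2 then p.1 z else (τ z⁻¹)⁻¹ • p.2 z⁻¹

/-- The `w`-chart representative of a member: `g₁` on the disc `‖w‖ < 2`, the transferred `g₀`
outside. [folklore] -/
def sec₁ (τ : ℂ → ℂ) (p : ContDiffHolderFunction ℂ F k r × ContDiffHolderFunction ℂ F k r)
    (w : ℂ) : F :=
  if ‖w‖ < 2 then p.2 w else τ w • p.1 w⁻¹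

/-- On the disc `‖z‖ < 2` the `z`-representative is the first piece. [folklore] -/
theorem sec₀_of_norm_lt {p : ContDiffHolderFunction ℂ F k r × ContDiffHolderFunction ℂ F k r}
    {z : ℂ} (hz : ‖z‖ < 2) : sec₀ τ p z = p.1 z := by
  simp [sec₀, hz]

/-- On the disc `‖w‖ < 2` the `w`-representative is the second piece. [folklore] -/
theorem sec₁_of_norm_lt {p : ContDiffHolderFunction ℂ F k r × ContDiffHolderFunction ℂ F k r}
    {w : ℂ} (hw : ‖w‖ < 2) : sec₁ τ p w = p.2 w := by
  simp [sec₁, hw]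

section Member

variable {p : ContDiffHolderFunction ℂ F k r × ContDiffHolderFunction ℂ F k r}

/-- Outside the disc `‖z‖ ≤ 1/2` the `z`-representative is the transferred second piece.
[folklore] -/
theorem sec₀_of_half_lt (hp : p ∈ holderSections F τ k r) {z : ℂ}
    (hz : 2⁻¹ < ‖z‖) : sec₀ τ p z = (τ z⁻¹)⁻¹ • p.2 z⁻¹ := by
  by_cases h2 : ‖z‖ < 2
  · rw [sec₀_of_norm_lt h2, hp.1 z hz.le, rhoCut_eq_one h2.le]
    simp
  · simp [sec₀, h2]

/-- Outside the disc `‖w‖ ≤ 1/2` the `w`-representative is the transferred first piece.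
[folklore] -/
theorem sec₁_of_half_lt (hp : p ∈ holderSections F τ k r) {w : ℂ} (hw : 2⁻¹ < ‖w‖) :
    sec₁ τ p w = τ w • p.1 w⁻¹ := by
  by_cases h2 : ‖w‖ < 2
  · rw [sec₁_of_norm_lt h2, hp.2 w hw.le, rhoCut_eq_one h2.le]
    simp
  · simp [sec₁, h2]

/-- **The first piece is `ρ • sec₀`.** [folklore] -/
theorem fst_eq_rhoCut_smul_sec₀ (hp : p ∈ holderSections F τ k r)
    (z : ℂ) : p.1 z = (rhoCut z : ℂ) • sec₀ τ p z := by
  by_cases h2 : ‖z‖ < 2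
  · rw [sec₀_of_norm_lt h2, rhoCut_eq_one h2.le]
    simp
  · have hz : 2⁻¹ < ‖z‖ := lt_of_lt_of_le (by norm_num) (not_lt.1 h2)
    rw [sec₀_of_half_lt hp hz, hp.1 z hz.le, mul_smul]

/-- **The second piece is `ρ • sec₁`.** [folklore] -/
theorem snd_eq_rhoCut_smul_sec₁ (hp : p ∈ holderSections F τ k r) (w : ℂ) :
    p.2 w = (rhoCut w : ℂ) • sec₁ τ p w := by
  by_cases h2 : ‖w‖ < 2
  · rw [sec₁_of_norm_lt h2, rhoCut_eq_one h2.le]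
    simp
  · have hw : 2⁻¹ < ‖w‖ := lt_of_lt_of_le (by norm_num) (not_lt.1 h2)
    rw [sec₁_of_half_lt hp hw, hp.2 w hw.le, mul_smul]

/-- **The clutching relation** `sec₁ w = τ w • sec₀ w⁻¹` (`w ≠ 0`). [folklore] -/
theorem sec₁_eq_smul_sec₀ (hp : p ∈ holderSections F τ k r) (hτ : ∀ w, w ≠ 0 → τ w ≠ 0)
    {w : ℂ} (hw : w ≠ 0) : sec₁ τ p w = τ w • sec₀ τ p w⁻¹ := by
  by_cases h2 : ‖w‖ < 2
  · -- `‖w⁻¹‖ > 1/2`: the `z`-representative at `w⁻¹` is the transferred second piece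
    have hz : 2⁻¹ < ‖w⁻¹‖ := by
      rw [norm_inv]
      have := inv_strictAnti₀ (norm_pos_iff.2 hw) h2
      simpa using this
    rw [sec₀_of_half_lt hp hz, inv_inv, sec₁_of_norm_lt h2, smul_smul,
      mul_inv_cancel₀ (hτ w hw), one_smul]
  · have hw' : 2⁻¹ < ‖w‖ := lt_of_lt_of_le (by norm_num) (not_lt.1 h2)
    have hz : ‖w⁻¹‖ < 2 := norm_inv_lt_two_of_half_lt hw'
    rw [sec₁_of_half_lt hp hw', sec₀_of_norm_lt hz]

/-- The inverse clutching relation `sec₀ z = (τ z⁻¹)⁻¹ • sec₁ z⁻¹` (`z ≠ 0`). [folklore] -/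
theorem sec₀_eq_smul_sec₁ (hp : p ∈ holderSections F τ k r) (hτ : ∀ w, w ≠ 0 → τ w ≠ 0)
    {z : ℂ} (hz : z ≠ 0) : sec₀ τ p z = (τ z⁻¹)⁻¹ • sec₁ τ p z⁻¹ := by
  rw [sec₁_eq_smul_sec₀ hp hτ (inv_ne_zero hz), inv_inv, smul_smul,
    inv_mul_cancel₀ (hτ _ (inv_ne_zero hz)), one_smul]

/-- The first piece vanishes off the disc `‖z‖ < 3`. [folklore] -/
theorem fst_eq_zero_of_le (hp : p ∈ holderSections F τ k r)
    {z : ℂ} (hz : 3 ≤ ‖z‖) : p.1 z = 0 := by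
  rw [fst_eq_rhoCut_smul_sec₀ hp, rhoCut_eq_zero hz]
  simp

/-- The second piece vanishes off the disc `‖w‖ < 3`. [folklore] -/
theorem snd_eq_zero_of_le (hp : p ∈ holderSections F τ k r) {w : ℂ} (hw : 3 ≤ ‖w‖) :
    p.2 w = 0 := by
  rw [snd_eq_rhoCut_smul_sec₁ hp, rhoCut_eq_zero hw]
  simp

/-- The first piece is supported in the closed disc of radius `3`. [folklore] -/
theorem tsupport_fst_subset (hp : p ∈ holderSections F τ k r) :
    tsupport (p.1 : ℂ → F) ⊆ closedBall (0 : ℂ) 3 := by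
  refine closure_minimal (fun z hz => ?_) isClosed_closedBall
  rw [mem_closedBall, dist_zero_right]
  by_contra h
  exact hz (fst_eq_zero_of_le hp (not_le.1 h).le)

/-- The second piece is supported in the closed disc of radius `3`. [folklore] -/
theorem tsupport_snd_subset (hp : p ∈ holderSections F τ k r) :
    tsupport (p.2 : ℂ → F) ⊆ closedBall (0 : ℂ) 3 := by
  refine closure_minimal (fun w hw => ?_) isClosed_closedBall
  rw [mem_closedBall, dist_zero_right]
  by_contra h
  exact hw (snd_eq_zero_of_le hp (not_le.1 h).le)

/-- **Regularity of the `z`-representative**: it is `C^k` (indeed it is `g₀` near every point of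
the disc `‖z‖ < 2` and the transferred `g₁` near every point with `‖z‖ > 1/2`), provided `τ` is
smooth and zero-free off the origin. [folklore] -/
theorem contDiff_sec₀ (hp : p ∈ holderSections F τ k r) (hτ : ∀ w, w ≠ 0 → τ w ≠ 0)
    (hτs : ContDiffOn ℝ ∞ τ {w | w ≠ 0}) : ContDiff ℝ k (sec₀ τ p) := by
  refine contDiff_iff_contDiffAt.2 fun z => ?_
  by_cases h2 : ‖z‖ < 2
  · have hev : sec₀ τ p =ᶠ[𝓝 z] (p.1 : ℂ → F) := by
      filter_upwards [(isOpen_lt continuous_norm continuous_const).mem_nhds h2] with y hy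
      exact sec₀_of_norm_lt hy
    exact (p.1.contDiff.contDiffAt.congr_of_eventuallyEq hev)
  · have hz : 2⁻¹ < ‖z‖ := lt_of_lt_of_le (by norm_num) (not_lt.1 h2)
    have hev : sec₀ τ p =ᶠ[𝓝 z] fun y => (τ y⁻¹)⁻¹ • p.2 y⁻¹ := by
      filter_upwards [(isOpen_lt continuous_const continuous_norm).mem_nhds hz] with y hy
      exact sec₀_of_half_lt hp hy
    refine ContDiffAt.congr_of_eventuallyEq ?_ hev
    have hz0 : z ≠ 0 := ne_zero_of_half_le_norm hz.le
    have hinv : ContDiffAt ℝ k (fun y : ℂ => y⁻¹) z :=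
      ((contDiffAt_inv ℂ hz0).restrict_scalars ℝ).of_le le_top
    have hτz : ContDiffAt ℝ k τ z⁻¹ :=
      ((hτs z⁻¹ (inv_ne_zero hz0)).contDiffAt (isOpen_ne_zero.mem_nhds (inv_ne_zero hz0))).of_le
        (WithTop.coe_le_coe.mpr le_top)
    have h1 : ContDiffAt ℝ k (fun y => (τ y⁻¹)⁻¹) z :=
      ((hτz.comp z hinv).inv (hτ _ (inv_ne_zero hz0)))
    exact h1.smul (p.2.contDiff.contDiffAt.comp z hinv)

/-- **Regularity of the `w`-representative.** [folklore] -/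
theorem contDiff_sec₁ (hp : p ∈ holderSections F τ k r)
    (hτs : ContDiffOn ℝ ∞ τ {w | w ≠ 0}) : ContDiff ℝ k (sec₁ τ p) := by
  refine contDiff_iff_contDiffAt.2 fun w => ?_
  by_cases h2 : ‖w‖ < 2
  · have hev : sec₁ τ p =ᶠ[𝓝 w] (p.2 : ℂ → F) := by
      filter_upwards [(isOpen_lt continuous_norm continuous_const).mem_nhds h2] with y hy
      exact sec₁_of_norm_lt hy
    exact (p.2.contDiff.contDiffAt.congr_of_eventuallyEq hev)
  · have hw : 2⁻¹ < ‖w‖ := lt_of_lt_of_le (by norm_num) (not_lt.1 h2)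
    have hev : sec₁ τ p =ᶠ[𝓝 w] fun y => τ y • p.1 y⁻¹ := by
      filter_upwards [(isOpen_lt continuous_const continuous_norm).mem_nhds hw] with y hy
      exact sec₁_of_half_lt hp hy
    refine ContDiffAt.congr_of_eventuallyEq ?_ hev
    have hw0 : w ≠ 0 := ne_zero_of_half_le_norm hw.le
    have hinv : ContDiffAt ℝ k (fun y : ℂ => y⁻¹) w :=
      ((contDiffAt_inv ℂ hw0).restrict_scalars ℝ).of_le le_top
    have hτw : ContDiffAt ℝ k τ w :=
      ((hτs w hw0).contDiffAt (isOpen_ne_zero.mem_nhds hw0)).of_le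
        (WithTop.coe_le_coe.mpr le_top)
    exact hτw.smul (p.1.contDiff.contDiffAt.comp w hinv)

end Member

/-! ### Membership from clutched representatives -/

/-- **Characterisation of members**: a pair of pieces belongs to `𝓗^{k,r}_τ` iff it is the pair
`(ρ • f₀, ρ • f₁)` of a clutched pair of representatives. [folklore] -/
theorem mem_holderSections_iff (hτ : ∀ w, w ≠ 0 → τ w ≠ 0)
    {p : ContDiffHolderFunction ℂ F k r × ContDiffHolderFunction ℂ F k r} :
    p ∈ holderSections F τ k r ↔ ∃ f₀ f₁ : ℂ → F, (∀ w, w ≠ 0 → f₁ w = τ w • f₀ w⁻¹) ∧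
      (∀ z, p.1 z = (rhoCut z : ℂ) • f₀ z) ∧ (∀ w, p.2 w = (rhoCut w : ℂ) • f₁ w) := by
  constructor
  · intro hp
    exact ⟨sec₀ τ p, sec₁ τ p, fun w hw => sec₁_eq_smul_sec₀ hp hτ hw,
      fst_eq_rhoCut_smul_sec₀ hp, snd_eq_rhoCut_smul_sec₁ hp⟩
  · rintro ⟨f₀, f₁, hcl, h0, h1⟩
    refine ⟨fun z hz => ?_, fun w hw => ?_⟩
    · have hz0 : z ≠ 0 := ne_zero_of_half_le_norm hz
      rw [h0 z, h1 z⁻¹, rhoCut_eq_one (norm_inv_le_two_of_half_le hz), hcl z⁻¹ (inv_ne_zero hz0),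
        inv_inv]
      simp only [Complex.ofReal_one, smul_smul]
      rw [one_mul, mul_assoc, inv_mul_cancel₀ (hτ _ (inv_ne_zero hz0)), mul_one]
    · have hw0 : w ≠ 0 := ne_zero_of_half_le_norm hw
      rw [h1 w, h0 w⁻¹, rhoCut_eq_one (norm_inv_le_two_of_half_le hw), hcl w hw0]
      simp only [Complex.ofReal_one, one_smul, smul_smul]

/-! ### Smooth sections are members -/

/-- A **smooth section**: a clutched pair of smooth chart representatives. [folklore] -/
structure SmoothSection (F : Type) [NormedAddCommGroup F] [NormedSpace ℂ F] (τ : ℂ → ℂ) where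
  /-- the `z`-chart representative -/
  f₀ : ℂ → F
  /-- the `w`-chart representative -/
  f₁ : ℂ → F
  smooth₀ : ContDiff ℝ ∞ f₀
  smooth₁ : ContDiff ℝ ∞ f₁
  clutch : ∀ w, w ≠ 0 → f₁ w = τ w • f₀ w⁻¹

namespace SmoothSection

variable (s : SmoothSection F τ)

/-- `ρ • f₀` is smooth. [folklore] -/
theorem contDiff_rhoCut_smul_f₀ : ContDiff ℝ ∞ fun z => (rhoCut z : ℂ) • s.f₀ z :=
  (Complex.ofRealCLM.contDiff.comp contDiff_rhoCut).smul s.smooth₀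

/-- `ρ • f₁` is smooth. [folklore] -/
theorem contDiff_rhoCut_smul_f₁ : ContDiff ℝ ∞ fun w => (rhoCut w : ℂ) • s.f₁ w :=
  (Complex.ofRealCLM.contDiff.comp contDiff_rhoCut).smul s.smooth₁

/-- `ρ • f₀` has compact support. [folklore] -/
theorem hasCompactSupport_rhoCut_smul_f₀ : HasCompactSupport fun z => (rhoCut z : ℂ) • s.f₀ z := by
  refine HasCompactSupport.smul_right ?_
  exact hasCompactSupport_rhoCut.comp_left Complex.ofReal_zero

/-- `ρ • f₁` has compact support. [folklore] -/
theorem hasCompactSupport_rhoCut_smul_f₁ : HasCompactSupport fun w => (rhoCut w : ℂ) • s.f₁ w := by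
  refine HasCompactSupport.smul_right ?_
  exact hasCompactSupport_rhoCut.comp_left Complex.ofReal_zero

/-- The first piece `ρ • f₀` of a smooth section as a member of `C^{k,r}_b` (`r ≤ 1`). [folklore] -/
def piece₀ (hr : r ≤ 1) : ContDiffHolderFunction ℂ F k r :=
  ⟨fun z => (rhoCut z : ℂ) • s.f₀ z,
    MemContDiffHolder.of_contDiff_of_hasCompactSupport s.contDiff_rhoCut_smul_f₀
      s.hasCompactSupport_rhoCut_smul_f₀ hr⟩

/-- The second piece `ρ • f₁` of a smooth section as a member of `C^{k,r}_b` (`r ≤ 1`). [folklore] -/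
def piece₁ (hr : r ≤ 1) : ContDiffHolderFunction ℂ F k r :=
  ⟨fun w => (rhoCut w : ℂ) • s.f₁ w,
    MemContDiffHolder.of_contDiff_of_hasCompactSupport s.contDiff_rhoCut_smul_f₁
      s.hasCompactSupport_rhoCut_smul_f₁ hr⟩

/-- Pointwise formula for the first piece of a smooth section. [folklore] -/
@[simp] theorem piece₀_apply (hr : r ≤ 1) (z : ℂ) :
    s.piece₀ (k := k) hr z = (rhoCut z : ℂ) • s.f₀ z := rfl

/-- Pointwise formula for the second piece of a smooth section. [folklore] -/
@[simp] theorem piece₁_apply (hr : r ≤ 1) (w : ℂ) :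
    s.piece₁ (k := k) hr w = (rhoCut w : ℂ) • s.f₁ w := rfl

/-- **Smooth sections are members of every `𝓗^{k,r}_τ`** (`r ≤ 1`). [folklore] -/
theorem piece_mem (hτ : ∀ w, w ≠ 0 → τ w ≠ 0) (hr : r ≤ 1) :
    (s.piece₀ (k := k) hr, s.piece₁ (k := k) hr) ∈ holderSections F τ k r :=
  (mem_holderSections_iff hτ).2 ⟨s.f₀, s.f₁, s.clutch, fun _ => rfl, fun _ => rfl⟩

/-- A smooth section as a member of `𝓗^{k,r}_τ` (`r ≤ 1`). [folklore] -/
def toHolder (hτ : ∀ w, w ≠ 0 → τ w ≠ 0) (hr : r ≤ 1) : holderSections F τ k r :=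
  ⟨(s.piece₀ hr, s.piece₁ hr), s.piece_mem hτ hr⟩

/-- The first piece of `toHolder` is `ρ • f₀`. [folklore] -/
@[simp] theorem toHolder_fst_apply (hτ : ∀ w, w ≠ 0 → τ w ≠ 0) (hr : r ≤ 1) (z : ℂ) :
    (s.toHolder (k := k) hτ hr : ContDiffHolderFunction ℂ F k r ×
      ContDiffHolderFunction ℂ F k r).1 z = (rhoCut z : ℂ) • s.f₀ z := rfl

/-- The second piece of `toHolder` is `ρ • f₁`. [folklore] -/
@[simp] theorem toHolder_snd_apply (hτ : ∀ w, w ≠ 0 → τ w ≠ 0) (hr : r ≤ 1) (w : ℂ) :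
    (s.toHolder (k := k) hτ hr : ContDiffHolderFunction ℂ F k r ×
      ContDiffHolderFunction ℂ F k r).2 w = (rhoCut w : ℂ) • s.f₁ w := rfl

/-- The `z`-representative of a smooth section, read back from its pieces, is `f₀`. [folklore] -/
theorem sec₀_toHolder (hτ : ∀ w, w ≠ 0 → τ w ≠ 0) (hr : r ≤ 1) (z : ℂ) :
    sec₀ τ (s.toHolder (k := k) hτ hr : ContDiffHolderFunction ℂ F k r ×
      ContDiffHolderFunction ℂ F k r) z = s.f₀ z := by
  by_cases h2 : ‖z‖ < 2
  · rw [sec₀_of_norm_lt h2, toHolder_fst_apply, rhoCut_eq_one h2.le]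
    simp
  · have hz : 2⁻¹ < ‖z‖ := lt_of_lt_of_le (by norm_num) (not_lt.1 h2)
    have hz0 : z ≠ 0 := ne_zero_of_half_le_norm hz.le
    rw [show ((s.toHolder (k := k) hτ hr : holderSections F τ k r) :
        ContDiffHolderFunction ℂ F k r × ContDiffHolderFunction ℂ F k r) =
        (s.piece₀ hr, s.piece₁ hr) from rfl, sec₀_of_half_lt (s.piece_mem hτ hr) hz]
    change (τ z⁻¹)⁻¹ • ((rhoCut z⁻¹ : ℂ) • s.f₁ z⁻¹) = s.f₀ z
    rw [rhoCut_eq_one (norm_inv_le_two_of_half_le hz.le), s.clutch _ (inv_ne_zero hz0), inv_inv]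
    simp [smul_smul, inv_mul_cancel₀ (hτ _ (inv_ne_zero hz0))]

/-- The `w`-representative of a smooth section, read back from its pieces, is `f₁`. [folklore] -/
theorem sec₁_toHolder (hτ : ∀ w, w ≠ 0 → τ w ≠ 0) (hr : r ≤ 1) (w : ℂ) :
    sec₁ τ (s.toHolder (k := k) hτ hr : ContDiffHolderFunction ℂ F k r ×
      ContDiffHolderFunction ℂ F k r) w = s.f₁ w := by
  by_cases h2 : ‖w‖ < 2
  · rw [sec₁_of_norm_lt h2, toHolder_snd_apply, rhoCut_eq_one h2.le]
    simp
  · have hw : 2⁻¹ < ‖w‖ := lt_of_lt_of_le (by norm_num) (not_lt.1 h2)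
    have hw0 : w ≠ 0 := ne_zero_of_half_le_norm hw.le
    rw [show ((s.toHolder (k := k) hτ hr : holderSections F τ k r) :
        ContDiffHolderFunction ℂ F k r × ContDiffHolderFunction ℂ F k r) =
        (s.piece₀ hr, s.piece₁ hr) from rfl, sec₁_of_half_lt (s.piece_mem hτ hr) hw]
    change τ w • ((rhoCut w⁻¹ : ℂ) • s.f₀ w⁻¹) = s.f₁ w
    rw [rhoCut_eq_one (norm_inv_le_two_of_half_le hw.le), s.clutch _ hw0]
    simp

end SmoothSection

/-! ### Evaluation at a point of the `z`-disc -/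

/-- **Evaluation of the `z`-representative at a point of the disc `‖z₀‖ < 2`**, a continuous
linear functional on `𝓗^{k,r}_τ`. [folklore] -/
def eval₀CLM (τ : ℂ → ℂ) (k : ℕ) (r : ℝ≥0) (z₀ : ℂ) : holderSections F τ k r →L[ℝ] F :=
  ((ContDiffHolderFunction.evalCLM (E := ℂ) (F := F) (k := k) (r := r) z₀).comp
    (ContinuousLinearMap.fst ℝ _ _)).comp (holderSections F τ k r).subtypeL

/-- `eval₀CLM z₀` evaluates the first piece at `z₀`. [folklore] -/
theorem eval₀CLM_apply (z₀ : ℂ) (p : holderSections F τ k r) :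
    eval₀CLM (F := F) τ k r z₀ p = (p : ContDiffHolderFunction ℂ F k r ×
      ContDiffHolderFunction ℂ F k r).1 z₀ := rfl

/-- On the disc `‖z₀‖ < 2`, `eval₀CLM z₀` evaluates the `z`-representative. [folklore] -/
theorem eval₀CLM_eq_sec₀ {z₀ : ℂ} (hz₀ : ‖z₀‖ < 2) (p : holderSections F τ k r) :
    eval₀CLM (F := F) τ k r z₀ p = sec₀ τ (p : ContDiffHolderFunction ℂ F k r ×
      ContDiffHolderFunction ℂ F k r) z₀ := by
  rw [eval₀CLM_apply, sec₀_of_norm_lt hz₀]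

/-- **Evaluation of the `w`-representative at a point of the disc `‖w₀‖ < 2`.** [folklore] -/
def eval₁CLM (τ : ℂ → ℂ) (k : ℕ) (r : ℝ≥0) (w₀ : ℂ) : holderSections F τ k r →L[ℝ] F :=
  ((ContDiffHolderFunction.evalCLM (E := ℂ) (F := F) (k := k) (r := r) w₀).comp
    (ContinuousLinearMap.snd ℝ _ _)).comp (holderSections F τ k r).subtypeL

/-- `eval₁CLM w₀` evaluates the second piece at `w₀`. [folklore] -/
theorem eval₁CLM_apply (w₀ : ℂ) (p : holderSections F τ k r) :
    eval₁CLM (F := F) τ k r w₀ p = (p : ContDiffHolderFunction ℂ F k r ×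
      ContDiffHolderFunction ℂ F k r).2 w₀ := rfl

/-! ### The compact inclusion `𝓗^{k+1,r}_τ → 𝓗^{k,r}_τ` -/

section Incl

variable [CompleteSpace F]

/-- The inclusion `𝓗^{k+1,r}_τ → 𝓗^{k,r}_τ` (`r ≤ 1`). [folklore] -/
def inclCLM (hr : r ≤ 1) : holderSections F τ (k + 1) r →L[ℝ] holderSections F τ k r :=
  (((ContDiffHolderFunction.inclCLM hr).prodMap (ContDiffHolderFunction.inclCLM hr)).comp
    (holderSections F τ (k + 1) r).subtypeL).codRestrict (holderSections F τ k r) fun p => by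
      obtain ⟨hp1, hp2⟩ := p.2
      exact ⟨fun z hz => hp1 z hz, fun w hw => hp2 w hw⟩

/-- The inclusion does not change the first piece. [folklore] -/
@[simp] theorem inclCLM_fst_apply (hr : r ≤ 1) (p : holderSections F τ (k + 1) r) (z : ℂ) :
    (inclCLM (F := F) hr p : ContDiffHolderFunction ℂ F k r × ContDiffHolderFunction ℂ F k r).1 z
      = (p : ContDiffHolderFunction ℂ F (k + 1) r × ContDiffHolderFunction ℂ F (k + 1) r).1 z :=
  rfl

/-- The inclusion does not change the second piece. [folklore] -/
@[simp] theorem inclCLM_snd_apply (hr : r ≤ 1) (p : holderSections F τ (k + 1) r) (w : ℂ) :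
    (inclCLM (F := F) hr p : ContDiffHolderFunction ℂ F k r × ContDiffHolderFunction ℂ F k r).2 w
      = (p : ContDiffHolderFunction ℂ F (k + 1) r × ContDiffHolderFunction ℂ F (k + 1) r).2 w :=
  rfl

/-- The inclusion `𝓗^{k+1,r}_τ → 𝓗^{k,r}_τ` is injective. [folklore] -/
theorem inclCLM_injective (hr : r ≤ 1) : Injective (inclCLM (F := F) (τ := τ) (k := k) hr) := by
  intro p q h
  apply Subtype.ext
  apply Prod.ext
  · exact ContDiffHolderFunction.ext fun z => by
      simpa using congrArg (fun u : holderSections F τ k r =>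
        (u : ContDiffHolderFunction ℂ F k r × ContDiffHolderFunction ℂ F k r).1 z) h
  · exact ContDiffHolderFunction.ext fun w => by
      simpa using congrArg (fun u : holderSections F τ k r =>
        (u : ContDiffHolderFunction ℂ F k r × ContDiffHolderFunction ℂ F k r).2 w) h

/-- **Compactness of the inclusion `𝓗^{k+1,r}_τ → 𝓗^{k,r}_τ`** (`0 < r ≤ 1`, `F` finite
dimensional, `τ` zero-free off the origin): both pieces of a bounded sequence are bounded in
`C^{k+1,r}_b` and supported in the disc `‖z‖ ≤ 3`, so by Arzelà–Ascoli a subsequence converges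
in `C^{k,r}_b` piecewise, and the limit pair again satisfies the (closed) piece relations.
[cite: GilbargTrudinger2001, Lemma 6.36] -/
theorem isCompactOperator_inclCLM [FiniteDimensional ℂ F] (hr0 : 0 < r) (hr : r ≤ 1) :
    IsCompactOperator (inclCLM (F := F) (τ := τ) (k := k) hr) := by
  haveI : FiniteDimensional ℝ F := FiniteDimensional.trans ℝ ℂ F
  -- the two piece maps `𝓗^{k+1,r} → C^{k,r}_b` are compact
  set L₁ : holderSections F τ (k + 1) r →L[ℝ] ContDiffHolderFunction ℂ F (k + 1) r :=
    (ContinuousLinearMap.fst ℝ _ _).comp (holderSections F τ (k + 1) r).subtypeL with hL₁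
  set L₂ : holderSections F τ (k + 1) r →L[ℝ] ContDiffHolderFunction ℂ F (k + 1) r :=
    (ContinuousLinearMap.snd ℝ _ _).comp (holderSections F τ (k + 1) r).subtypeL with hL₂
  have hK : IsCompact (closedBall (0 : ℂ) 3) := isCompact_closedBall _ _
  have h₁ : IsCompactOperator ((ContDiffHolderFunction.inclCLM hr).comp L₁) :=
    ContDiffHolderFunction.isCompactOperator_inclCLM_comp hr0 hr L₁ hK fun p =>
      tsupport_fst_subset p.2
  have h₂ : IsCompactOperator ((ContDiffHolderFunction.inclCLM hr).comp L₂) :=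
    ContDiffHolderFunction.isCompactOperator_inclCLM_comp hr0 hr L₂ hK fun p =>
      tsupport_snd_subset p.2
  -- hence so is their product, with values in the closed submodule
  obtain ⟨K₁, hK₁, hK₁f⟩ := h₁
  obtain ⟨K₂, hK₂, hK₂f⟩ := h₂
  have hprod : IsCompactOperator (fun p : holderSections F τ (k + 1) r =>
      (((ContDiffHolderFunction.inclCLM hr).comp L₁) p,
        ((ContDiffHolderFunction.inclCLM hr).comp L₂) p)) :=
    ⟨K₁ ×ˢ K₂, hK₁.prod hK₂, Filter.mem_of_superset (Filter.inter_mem hK₁f hK₂f)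
      fun p hp => ⟨hp.1, hp.2⟩⟩
  have hcod := hprod.codRestrict (V := holderSections F τ k r)
    (fun p => ⟨fun z hz => p.2.1 z hz, fun w hw => p.2.2 w hw⟩) isClosed_holderSections
  exact hcod

end Incl

end RiemannSphere

end Literature.Analysis.Complex

end
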